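import Literature.Probability.RandomPlanarGeometry.HexSAWRotStripLogDecay
import Literature.Probability.RandomPlanarGeometry.HexSAWRotStripLimit
import HarnessLib

/-!
# The lateral class of Beaton's rotated strip vanishes in the infinite-width limit (`E^⊥_{H,W}(x_c) → 0`)

Topic `Literature/Probability/RandomPlanarGeometry`; lane «pcv-sawmu», door R96 «BEATON-YC» (planner a-idea-1 g17, `Sketch_G17.lean`
ed.2 7a0bd869, face **Y3 `RotELimZeroY` at `y = 1`**); prover a-p6 g7.  Sources: N. R. Beaton, *The critical surface fugacity of
self-avoiding walks on a rotated honeycomb lattice*, J. Phys. A 47 (2014) 075003 (arXiv:1210.0274v3), §2.2 (the domain `D_{T,L}` and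
its exit classes), Proposition 4 (the strip identity) and §3–§4 (the limit `L → ∞`); A. Glazman, I. Manolescu, arXiv:1708.00395v3,
Corollary 2.3 (the parallel-frame statement `E_T = 0`, tree `HV.stripElim_zero`) and §4.1.

For Beaton's domain `D(H, W)` (`HV.rotStripV H W`) write `E^⊥_{H,W} := rotGF ((rotStripV H W).erase wOut) (IsRotLatDart H W)` for the
right-started generating function at `x_c` of the walks from the mid-edge `a` leaving through a LATERAL line `|X − 3| = 3W` along a
`Δξ = 0` edge (Beaton's `E_{T,L}(x_c)`, right-started half).

* `rotStripV_mono_height`, `rotGF_mono_of_imp` — domain/class monotonicity;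
* `rotStripLat_add_top_le_rotTriW` — **`c_E · E^⊥_{H,W} + c_B · B^⊥_{H,W} ≤ W_M`** for `6M+2 ≤ H`, `2M+1 ≤ W` (the strip identity
  K95.1 minus the triangle identity K95.2, keeping the lateral class; cf. the tree's `rotStripBR_le_rotTriW`, which drops it);
* `rotStripLat_succ_antitone` — `W ↦ E^⊥_{H,W+1}` is non-increasing (the other four classes grow with the width, the identity is
  constant); `rotStripLat_mono_height` — `E^⊥_{H,W} ≤ E^⊥_{H',W}` for `H ≤ H'`;
* `rotTriW_le_log` — `W_N ≤ C (log N)^{−1/3}` for Beaton's rotated triangles (`RotGM.logRate_of_blocks` ⊕ `rotTriBlockIneq_holds`),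
  hence `tendsto_rotTriW_zero`;
* `rotStripBR_pos`, **`iSup_rotStripBR_pos`** — support S0 of the lane's R96 core (`RotStripBlimPos`): `⨆_W B^{⊥,→}_{D(H,W)}(x_c) > 0`
  (straight span-`H` brick-wall bridge through the tree's `HexBW.rot_dictionary`);
* **`tendsto_rotStripLat_zero`** — `E^⊥_{H,W}(x_c) → 0` as `W → ∞`, for every `H ≥ 1`: the infimum `E^⊥_H = inf_W E^⊥_{H,W}` is
  non-decreasing in `H` and bounded by `W_{⌊(H−2)/6⌋}/c_E → 0`, hence zero for every `H` — the rotated-frame twin of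
  Glazman–Manolescu's Corollary 2.3 / the tree's `HV.stripElim_zero`, and the `y = 1` case of the lane's face Y3 `RotELimZeroY`
  (whose boundedness hypothesis on `B^⊥(y)` is automatic at `y = 1`) = Beaton 2014, §4, **Corollary 13 at `y = 1`** AS PRINTED
  («`E_T(x_c,y) := lim_L E_{T,L}(x_c,y) = 0` for `0 ≤ y < y†`», arXiv v3 p. 17; printed proof via the radius of convergence of `Ĉ_T`,
  Cor. 10 — the proof here is different: triangle comparison + the block inequality; label CONSOLIDATION, lit-1 g11 05:08:34Z).
-/

noncomputable section

open Finset Filter Topology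

namespace Literature.Probability.RandomPlanarGeometry.SAW.HV

/-! ### Monotonicity in the height and in the class -/

/-- `D(H, W) ⊆ D(H', W)` for `H ≤ H'` (the height constraint `−ξ ≤ H` relaxes). [cite: Beaton2014RotatedHoneycomb, §2.2 (the domain D_{T,L})] -/
theorem rotStripV_mono_height {H H' Wd : ℕ} (h : H ≤ H') : rotStripV H Wd ⊆ rotStripV H' Wd := by
  intro v hv
  have hH : (H : ℤ) ≤ H' := by exact_mod_cast h
  rw [mem_rotStripV_iff] at hv ⊢
  rcases hv with h1 | h1 | ⟨h1, h2, h3⟩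
  · exact Or.inl h1
  · exact Or.inr (Or.inl h1)
  · exact Or.inr (Or.inr ⟨h1, h2.trans hH, h3⟩)

/-- Class generating functions are monotone under domain inclusion AND class implication (the walks of the smaller domain whose
final dart lies in the smaller class are among those of the larger). [cite: GlazmanManolescu2019, §4.1 (eq. (4.1): monotonicity of the classes in the domain)] -/
theorem rotGF_mono_of_imp {V V' : Finset HV} (hV : V ⊆ V') (cls cls' : HV × HV → Prop) [DecidablePred cls]
    [DecidablePred cls'] (h : ∀ d, cls d → cls' d) : rotGF V cls ≤ rotGF V' cls' := by
  apply sum_le_sum_of_subset_of_nonneg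
  · intro P hP
    simp only [mem_filter] at hP ⊢
    exact ⟨mem_midWalks_iff.2 ((mem_midWalks_iff.1 hP.1).mono hV), h _ hP.2⟩
  · intro P _ _
    exact pow_nonneg hexCriticalFugacity_pos_lt_one.1.le _

/-- The lateral class `E^⊥_{H,W}` is non-decreasing in the HEIGHT at fixed width: a lateral exit of `D(H, W)` (a `Δξ = 0` edge at
height `≤ H` through `|X − 3| = 3W`) is a lateral exit of `D(H', W)`, `H ≤ H'`. (Parallel frame: `HV.stripE_mono_T`.)
[cite: Beaton2014RotatedHoneycomb, §2.2 (the classes of D_{T,L}); KrachunPanagiotis2026, Lemma 2.3 (proof, parallel frame)] -/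
theorem rotStripLat_mono_height {H H' : ℕ} (h : H ≤ H') (Wd : ℕ) :
    rotGF ((rotStripV H Wd).erase wOut) (IsRotLatDart H Wd) ≤ rotGF ((rotStripV H' Wd).erase wOut) (IsRotLatDart H' Wd) := by
  have hH : (H : ℤ) ≤ H' := by exact_mod_cast h
  refine rotGF_mono_of_imp (erase_subset_erase _ (rotStripV_mono_height h)) _ _ fun d hd => ?_
  obtain ⟨h1, h2, h3, h4⟩ := hd
  exact ⟨h1, h2, h3.trans hH, h4⟩

/-! ### The comparison keeping the lateral class -/

/-- `c_E = 2cos(3π/16) > 0`. [cite: Beaton2014RotatedHoneycomb, Proposition 4 (the coefficients)] -/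
private theorem cE_posL : 0 < 2 * Real.cos (3 * Real.pi / 16) := by
  have := Real.cos_pos_of_mem_Ioo (x := 3 * Real.pi / 16) ⟨by linarith [Real.pi_pos], by linarith [Real.pi_pos]⟩
  linarith

/-- **`c_E · E^⊥_{H,W} + c_B · B^⊥_{H,W} ≤ W_M` for `T_M ⊆ D(H, W)`** (`6M + 2 ≤ H`, `2M + 1 ≤ W`): subtract the triangle identity
(`rotTri_identity`) from the strip identity (`rotStrip_identity`) and use class monotonicity for the bottom exits and the closings —
the tree's `rotStripBR_le_rotTriW` with the lateral term kept. [cite: GlazmanManolescu2019, Lemma 4.1 and §4.1 (eq. (4.1)); Beaton2014RotatedHoneycomb, Proposition 4] -/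
theorem rotStripLat_add_top_le_rotTriW {M H Wd : ℕ} (hH : 6 * M + 2 ≤ H) (hW : 2 * M + 1 ≤ Wd) :
    2 * Real.cos (3 * Real.pi / 16) * rotGF ((rotStripV H Wd).erase wOut) (IsRotLatDart H Wd) +
      2 * Real.cos (Real.pi / 16) * rotStripBR H Wd ≤ rotTriW M := by
  obtain ⟨cO, cI, -, cP, -⟩ := rot_coeff_pos
  have e1 := rotStrip_identity (H := H) (Wd := Wd) (by omega) (by omega)
  have e2 := rotTri_identity M
  have hsub : (rotTriV M).erase wOut ⊆ (rotStripV H Wd).erase wOut :=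
    erase_subset_erase _ (rotTriV_subset_rotStripV hH hW)
  rw [rotStripBR_eq_rotGF]
  linarith [mul_le_mul_of_nonneg_left (rotGF_mono hsub IsRotBotOut) cO.le,
    mul_le_mul_of_nonneg_left (rotGF_mono hsub IsRotBotIn) cI.le,
    mul_le_mul_of_nonneg_left (rotGF_mono hsub IsRotCloseDart) cP.le]

/-- Corollary: `E^⊥_{H,W} ≤ W_M / c_E` for `T_M ⊆ D(H, W)`. [cite: GlazmanManolescu2019, Lemma 4.1 and §4.1; Beaton2014RotatedHoneycomb, Proposition 4] -/
theorem rotStripLat_le_rotTriW_div {M H Wd : ℕ} (hH : 6 * M + 2 ≤ H) (hW : 2 * M + 1 ≤ Wd) :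
    rotGF ((rotStripV H Wd).erase wOut) (IsRotLatDart H Wd) ≤ rotTriW M / (2 * Real.cos (3 * Real.pi / 16)) := by
  obtain ⟨-, -, -, -, cB⟩ := rot_coeff_pos
  have h := rotStripLat_add_top_le_rotTriW hH hW
  have hB := rotStripBR_nonneg H Wd
  rw [le_div_iff₀ cE_posL]
  nlinarith

/-! ### The width limit of the lateral class -/

/-- `E^⊥_{H,W} ≥ 0`. [cite: Beaton2014RotatedHoneycomb, §2.2] -/
theorem rotStripLat_nonneg (H Wd : ℕ) : 0 ≤ rotGF ((rotStripV H Wd).erase wOut) (IsRotLatDart H Wd) :=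
  rotGF_nonneg _ _

/-- **`W ↦ E^⊥_{H,W+1}` is non-increasing** (`H ≥ 1`): in the strip identity `c_O A^O + c_I A^I + c_E E + c_B B + c_P' P = K/2` the
four classes `A^O, A^I, B, P` do not depend on the width and their domains grow with it. [cite: Beaton2014RotatedHoneycomb, Proposition 4 and §3 (the limit L → ∞)] -/
theorem rotStripLat_succ_antitone {H : ℕ} (hH : 1 ≤ H) :
    Antitone fun Wd : ℕ => rotGF ((rotStripV H (Wd + 1)).erase wOut) (IsRotLatDart H (Wd + 1)) := by
  obtain ⟨cO, cI, cE, cP, cB⟩ := rot_coeff_pos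
  refine antitone_nat_of_succ_le fun n => ?_
  have e1 := rotStrip_identity (H := H) (Wd := n + 1) hH (by omega)
  have e2 := rotStrip_identity (H := H) (Wd := n + 1 + 1) hH (by omega)
  have hsub : (rotStripV H (n + 1)).erase wOut ⊆ (rotStripV H (n + 1 + 1)).erase wOut :=
    erase_subset_erase _ (rotStripV_mono_width (by omega))
  have hO := mul_le_mul_of_nonneg_left (rotGF_mono hsub IsRotBotOut) cO.le
  have hI := mul_le_mul_of_nonneg_left (rotGF_mono hsub IsRotBotIn) cI.le
  have hP := mul_le_mul_of_nonneg_left (rotGF_mono hsub IsRotCloseDart) cP.le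
  have hT := mul_le_mul_of_nonneg_left (rotGF_mono hsub (IsRotTopDart H)) (by linarith : (0:ℝ) ≤ 2 * Real.cos (Real.pi / 16))
  nlinarith

/-- The width limit `E^⊥_H := inf_W E^⊥_{H,W+1}` and the convergence `E^⊥_{H,W+1} → E^⊥_H` (monotone and bounded below by `0`).
[cite: Beaton2014RotatedHoneycomb, §3 (existence of the limits L → ∞)] -/
theorem tendsto_rotStripLat_ciInf {H : ℕ} (hH : 1 ≤ H) :
    Tendsto (fun Wd : ℕ => rotGF ((rotStripV H (Wd + 1)).erase wOut) (IsRotLatDart H (Wd + 1))) atTop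
      (𝓝 (⨅ Wd : ℕ, rotGF ((rotStripV H (Wd + 1)).erase wOut) (IsRotLatDart H (Wd + 1)))) :=
  tendsto_atTop_ciInf (rotStripLat_succ_antitone hH) ⟨0, fun _ ⟨_, hx⟩ => hx ▸ rotStripLat_nonneg _ _⟩

/-! ### `W_M → 0` and the conclusion -/

/-- **`W_N ≤ C (log N)^{−1/3}` for Beaton's rotated triangles** (`N ≥ 2`): the block inequality K95.4 fed into the abstract log-rate lemma.
[cite: GlazmanManolescu2019, Proposition 1.1 and §4.1] -/
theorem rotTriW_le_log : ∃ C : ℝ, 0 ≤ C ∧ ∀ N : ℕ, 2 ≤ N → rotTriW N ≤ C * Real.log N ^ (-(1 : ℝ) / 3) := by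
  obtain ⟨A, hA, hblock⟩ := rotTriBlockIneq_holds
  exact RotGM.logRate_of_blocks (r := 20) (by norm_num) rotTriW_nonneg (fun M => (rotTriW_le M).2) rotTriW_antitone hA hblock

/-- `W_M → 0` as `M → ∞`. [cite: GlazmanManolescu2019, Proposition 1.1] -/
theorem tendsto_rotTriW_zero : Tendsto rotTriW atTop (𝓝 0) := by
  obtain ⟨C, hC0, hC⟩ := rotTriW_le_log
  have hlog : Tendsto (fun N : ℕ => C * Real.log N ^ (-(1:ℝ) / 3)) atTop (𝓝 0) := by
    have h1 : Tendsto (fun x : ℝ => x ^ (-((1:ℝ) / 3))) atTop (𝓝 0) := tendsto_rpow_neg_atTop (by norm_num)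
    have h2 : Tendsto (fun N : ℕ => Real.log (N : ℝ)) atTop atTop := Real.tendsto_log_atTop.comp tendsto_natCast_atTop_atTop
    have h3 := (h1.comp h2).const_mul C
    simp only [mul_zero] at h3
    refine h3.congr' (Eventually.of_forall fun N => ?_)
    simp only [Function.comp, neg_div]
  refine tendsto_of_tendsto_of_tendsto_of_le_of_le' tendsto_const_nhds hlog (Eventually.of_forall rotTriW_nonneg) ?_
  filter_upwards [eventually_ge_atTop 2] with N hN using hC N hN

/-- **The lateral class of Beaton's rotated strip vanishes as the width grows: `E^⊥_{H,W}(x_c) → 0` (`W → ∞`) for every `H ≥ 1`.**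
Proof: `E^⊥_H := inf_W E^⊥_{H,W}` is non-decreasing in `H` (`rotStripLat_mono_height`) and `E^⊥_{H'} ≤ W_{⌊(H'−2)/6⌋}/c_E → 0`
(`rotStripLat_le_rotTriW_div`, `tendsto_rotTriW_zero`), so `E^⊥_H = 0`; then `E^⊥_{H,W} ↓ 0`.  Rotated-frame twin of Glazman–Manolescu's
Corollary 2.3 (`E_T = 0`, tree `HV.stripElim_zero`); the `y = 1` case of the lane's face Y3 `RotELimZeroY` = Beaton's
Corollary 13 («for `0 ≤ y < y†`, `E_T(x_c, y) := lim_L E_{T,L}(x_c, y) = 0`») AT `y = 1`, AS PRINTED; the proof here (triangle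
comparison + block inequality, no radius of convergence) is the lane's, not the printed one.
[cite: Beaton2014RotatedHoneycomb, §4, Corollary 13 (arXiv:1210.0274v3 p. 17) and the limit identity (p. 16); GlazmanManolescu2019, Corollary 2.3 and §4.1] -/
theorem tendsto_rotStripLat_zero {H : ℕ} (hH : 1 ≤ H) :
    Tendsto (fun Wd : ℕ => rotGF ((rotStripV H Wd).erase wOut) (IsRotLatDart H Wd)) atTop (𝓝 0) := by
  -- notation: `e H' W := E^⊥_{H', W+1}`, `L H' := ⨅_W e H' W`
  set e : ℕ → ℕ → ℝ := fun H' Wd => rotGF ((rotStripV H' (Wd + 1)).erase wOut) (IsRotLatDart H' (Wd + 1)) with he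
  have hbdd : ∀ H', BddBelow (Set.range (e H')) := fun H' => ⟨0, fun _ ⟨_, hx⟩ => hx ▸ rotStripLat_nonneg _ _⟩
  have hlim : ∀ H', 1 ≤ H' → Tendsto (e H') atTop (𝓝 (⨅ Wd, e H' Wd)) := fun H' hH' => tendsto_rotStripLat_ciInf hH'
  -- the infimum is nonnegative, non-decreasing in the height, and bounded by `W_M / c_E`
  have hL0 : ∀ H', 0 ≤ ⨅ Wd, e H' Wd := fun H' => le_ciInf fun Wd => rotStripLat_nonneg _ _
  have hLmono : ∀ H', H ≤ H' → (⨅ Wd, e H Wd) ≤ ⨅ Wd, e H' Wd := fun H' hHH' =>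
    le_ciInf fun Wd => (ciInf_le (hbdd H) Wd).trans (rotStripLat_mono_height hHH' (Wd + 1))
  have hLle : ∀ M, 1 ≤ M → (⨅ Wd, e (6 * M + 2) Wd) ≤ rotTriW M / (2 * Real.cos (3 * Real.pi / 16)) := fun M hM =>
    (ciInf_le (hbdd (6 * M + 2)) (2 * M)).trans (rotStripLat_le_rotTriW_div le_rfl (by omega))
  -- hence `⨅_W e H W ≤ W_M / c_E` for every large `M`, and `W_M → 0`
  have hL : (⨅ Wd, e H Wd) = 0 := by
    refine le_antisymm ?_ (hL0 H)
    have hlim0 : Tendsto (fun M : ℕ => rotTriW M / (2 * Real.cos (3 * Real.pi / 16))) atTop (𝓝 0) := by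
      simpa using tendsto_rotTriW_zero.div_const (2 * Real.cos (3 * Real.pi / 16))
    refine ge_of_tendsto hlim0 ?_
    filter_upwards [eventually_ge_atTop (max H 1)] with M hM
    have hM1 : 1 ≤ M := le_of_max_le_right hM
    have hHM : H ≤ 6 * M + 2 := by have := le_of_max_le_left hM; omega
    exact (hLmono _ hHM).trans (hLle M hM1)
  -- conclude for the shifted sequence, then unshift
  have h1 : Tendsto (e H) atTop (𝓝 0) := hL ▸ hlim H hH
  exact (tendsto_add_atTop_iff_nat 1).1 h1

/-! ### The infinite-strip identity in Beaton's frame (`W → ∞` at `y = 1`) -/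

/-- A width-independent class of `D(H, ·)` has a non-decreasing, bounded generating function, hence converges to its supremum
(`A^O`, `A^I`, `P`; for the top class `B` this is the tree's `HV.tendsto_rotStripBR`). [cite: Beaton2014RotatedHoneycomb, §3 (the limit L → ∞ of the strip identity: the width-independent classes are monotone and bounded)] -/
theorem tendsto_rotGF_width {H : ℕ} (hH : 1 ≤ H) (cls : HV × HV → Prop) [DecidablePred cls]
    {c : ℝ} (hc : 0 < c)
    (hle : ∀ Wd, 1 ≤ Wd → c * rotGF ((rotStripV H Wd).erase wOut) cls ≤ 2 * hexCriticalFugacity * Real.cos (Real.pi / 16)) :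
    Tendsto (fun Wd : ℕ => rotGF ((rotStripV H Wd).erase wOut) cls) atTop
      (𝓝 (⨆ Wd : ℕ, rotGF ((rotStripV H Wd).erase wOut) cls)) := by
  have _ := hH
  refine tendsto_atTop_ciSup (fun a b hab => rotGF_mono (erase_subset_erase _ (rotStripV_mono_width hab)) cls) ?_
  refine ⟨2 * hexCriticalFugacity * Real.cos (Real.pi / 16) / c, ?_⟩
  rintro _ ⟨Wd, rfl⟩
  rw [le_div_iff₀ hc, mul_comm]
  rcases Nat.eq_zero_or_pos Wd with rfl | hpos
  · exact (mul_le_mul_of_nonneg_left (rotGF_mono (erase_subset_erase _ (rotStripV_mono_width (Nat.zero_le 1))) cls)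
      hc.le).trans (hle 1 le_rfl)
  · exact hle Wd hpos

/-- **Beaton's strip identity in the infinite-width limit (`y = 1`)**: with `A^O_H, A^I_H, B_H, P_H` the `W → ∞` limits (suprema) of the
four width-independent classes of `D(H, W)`, `2sin(3π/16)·A^O_H + 2sin(π/16)·A^I_H + 2cos(π/16)·B_H + 2cos(7π/16)·P_H = 2x_c cos(π/16)`
for every `H ≥ 1` — the lateral term has disappeared (`tendsto_rotStripLat_zero`).  This is Beaton's limit identity (the display
after «`A^O_T := lim_L A^O_{T,L}`», arXiv v3 p. 16, and Corollary 13 p. 17) at `y = 1`, AS PRINTED; rotated-frame twin of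
Glazman–Manolescu's Corollary 2.3 / the tree's `HV.strip_identity_lim`.
[cite: Beaton2014RotatedHoneycomb, §4, Corollary 13 and the limit identity (arXiv:1210.0274v3 pp. 16–17); GlazmanManolescu2019, Corollary 2.3] -/
theorem rotStrip_identity_lim {H : ℕ} (hH : 1 ≤ H) :
    2 * Real.sin (3 * Real.pi / 16) * (⨆ Wd : ℕ, rotGF ((rotStripV H Wd).erase wOut) IsRotBotOut) +
      2 * Real.sin (Real.pi / 16) * (⨆ Wd : ℕ, rotGF ((rotStripV H Wd).erase wOut) IsRotBotIn) +
      2 * Real.cos (Real.pi / 16) * (⨆ Wd : ℕ, rotStripBR H Wd) +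
      2 * Real.cos (7 * Real.pi / 16) * (⨆ Wd : ℕ, rotGF ((rotStripV H Wd).erase wOut) IsRotCloseDart) =
    2 * hexCriticalFugacity * Real.cos (Real.pi / 16) := by
  obtain ⟨cO, cI, cE, cP, cB1⟩ := rot_coeff_pos
  have cB : 0 < 2 * Real.cos (Real.pi / 16) := by linarith
  -- each class is bounded by `K/2` through the identity (all other terms are nonnegative)
  have bnd : ∀ Wd, 1 ≤ Wd → ∀ V, V = (rotStripV H Wd).erase wOut →
      2 * Real.sin (3 * Real.pi / 16) * rotGF V IsRotBotOut ≤ 2 * hexCriticalFugacity * Real.cos (Real.pi / 16) ∧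
      2 * Real.sin (Real.pi / 16) * rotGF V IsRotBotIn ≤ 2 * hexCriticalFugacity * Real.cos (Real.pi / 16) ∧
      2 * Real.cos (Real.pi / 16) * rotGF V (IsRotTopDart H) ≤ 2 * hexCriticalFugacity * Real.cos (Real.pi / 16) ∧
      2 * Real.cos (7 * Real.pi / 16) * rotGF V IsRotCloseDart ≤ 2 * hexCriticalFugacity * Real.cos (Real.pi / 16) := by
    intro Wd hWd V hV
    have e := rotStrip_identity (H := H) (Wd := Wd) hH hWd
    rw [← hV] at e
    have h1 := mul_nonneg cO.le (rotGF_nonneg V IsRotBotOut)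
    have h2 := mul_nonneg cI.le (rotGF_nonneg V IsRotBotIn)
    have h3 := mul_nonneg cE.le (rotGF_nonneg V (IsRotLatDart H Wd))
    have h4 := mul_nonneg cB.le (rotGF_nonneg V (IsRotTopDart H))
    have h5 := mul_nonneg cP.le (rotGF_nonneg V IsRotCloseDart)
    exact ⟨by linarith, by linarith, by linarith, by linarith⟩
  have tO := tendsto_rotGF_width hH IsRotBotOut cO fun Wd hWd => (bnd Wd hWd _ rfl).1
  have tI := tendsto_rotGF_width hH IsRotBotIn cI fun Wd hWd => (bnd Wd hWd _ rfl).2.1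
  have tB : Tendsto (fun Wd : ℕ => rotStripBR H Wd) atTop (𝓝 (⨆ Wd : ℕ, rotStripBR H Wd)) := tendsto_rotStripBR hH
  have tP := tendsto_rotGF_width hH IsRotCloseDart cP fun Wd hWd => (bnd Wd hWd _ rfl).2.2.2
  have tE := tendsto_rotStripLat_zero hH
  -- the identity holds for every `W ≥ 1`; pass to the limit
  have lhs : Tendsto (fun Wd : ℕ =>
      2 * Real.sin (3 * Real.pi / 16) * rotGF ((rotStripV H Wd).erase wOut) IsRotBotOut +
        2 * Real.sin (Real.pi / 16) * rotGF ((rotStripV H Wd).erase wOut) IsRotBotIn +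
        2 * Real.cos (3 * Real.pi / 16) * rotGF ((rotStripV H Wd).erase wOut) (IsRotLatDart H Wd) +
        2 * Real.cos (Real.pi / 16) * rotStripBR H Wd +
        2 * Real.cos (7 * Real.pi / 16) * rotGF ((rotStripV H Wd).erase wOut) IsRotCloseDart) atTop
      (𝓝 (2 * Real.sin (3 * Real.pi / 16) * (⨆ Wd : ℕ, rotGF ((rotStripV H Wd).erase wOut) IsRotBotOut) +
        2 * Real.sin (Real.pi / 16) * (⨆ Wd : ℕ, rotGF ((rotStripV H Wd).erase wOut) IsRotBotIn) +
        2 * Real.cos (3 * Real.pi / 16) * 0 +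
        2 * Real.cos (Real.pi / 16) * (⨆ Wd : ℕ, rotStripBR H Wd) +
        2 * Real.cos (7 * Real.pi / 16) * (⨆ Wd : ℕ, rotGF ((rotStripV H Wd).erase wOut) IsRotCloseDart))) :=
    ((((tO.const_mul _).add (tI.const_mul _)).add (tE.const_mul _)).add (tB.const_mul _)).add (tP.const_mul _)
  have rhs : Tendsto (fun Wd : ℕ =>
      2 * Real.sin (3 * Real.pi / 16) * rotGF ((rotStripV H Wd).erase wOut) IsRotBotOut +
        2 * Real.sin (Real.pi / 16) * rotGF ((rotStripV H Wd).erase wOut) IsRotBotIn +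
        2 * Real.cos (3 * Real.pi / 16) * rotGF ((rotStripV H Wd).erase wOut) (IsRotLatDart H Wd) +
        2 * Real.cos (Real.pi / 16) * rotStripBR H Wd +
        2 * Real.cos (7 * Real.pi / 16) * rotGF ((rotStripV H Wd).erase wOut) IsRotCloseDart) atTop
      (𝓝 (2 * hexCriticalFugacity * Real.cos (Real.pi / 16))) := by
    refine tendsto_const_nhds.congr' ?_
    filter_upwards [eventually_ge_atTop 1] with Wd hWd
    have e := rotStrip_identity (H := H) (Wd := Wd) hH hWd
    rw [rotStripBR_eq_rotGF]
    linarith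
  have := tendsto_nhds_unique lhs rhs
  linarith

/-! ### Support S0: the top class of Beaton's strip is not empty (`B^⊥_H(x_c) > 0`) -/

/-- **`B^{⊥,→}_{D(H,H+1)}(x_c) > 0`** (`H ≥ 1`): the straight brick-wall bridge of `H` steps has span `H`, and the tree's dictionary
`HexBW.rot_dictionary` carries span-`H` bridges of length `< H + 1` into top-class walks of `D(H, H+1)`.
[cite: Beaton2014RotatedHoneycomb, §2 (PP-bridges of height T) and §3; MadrasSlade1993, §1.2 (the straight walk is a bridge)] -/
theorem rotStripBR_pos {H : ℕ} (hH : 1 ≤ H) : 0 < rotStripBR H (H + 1) := by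
  classical
  have hx := hexCriticalFugacity_pos_lt_one
  have hμ : 0 < hexConnectiveConstant := hexConnectiveConstant_pos
  -- the straight bridge of `H` steps has span `H`
  have hmem : Zd.straightWalk 2 H ∈ HexBW.brSpan H (H : ℤ) := by
    refine Finset.mem_filter.2 ⟨HexBW.straightWalk_mem_bridges H, ?_⟩
    simp [Zd.straightWalk]
  have hcard : (1 : ℝ) ≤ (#(HexBW.brSpan H (H : ℤ)) : ℝ) := by
    exact_mod_cast Finset.one_le_card.2 ⟨_, hmem⟩
  have hterm : 0 < (#(HexBW.brSpan H (H : ℤ)) : ℝ) / hexConnectiveConstant ^ H :=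
    div_pos (by linarith) (pow_pos hμ _)
  have hsum : (#(HexBW.brSpan H (H : ℤ)) : ℝ) / hexConnectiveConstant ^ H ≤
      ∑ m ∈ range (H + 1), (#(HexBW.brSpan m (H : ℤ)) : ℝ) / hexConnectiveConstant ^ m :=
    Finset.single_le_sum (f := fun m => (#(HexBW.brSpan m (H : ℤ)) : ℝ) / hexConnectiveConstant ^ m)
      (fun m _ => div_nonneg (Nat.cast_nonneg _) (pow_nonneg hμ.le _)) (Finset.mem_range.2 (Nat.lt_succ_self H))
  have hdict := HexBW.rot_dictionary H (H + 1) hH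
  have hpos : 0 < hexCriticalFugacity⁻¹ * rotStripBR H (H + 1) := lt_of_lt_of_le hterm (hsum.trans hdict)
  have hinv : 0 < hexCriticalFugacity⁻¹ := inv_pos.2 hx.1
  exact pos_of_mul_pos_right hpos hinv.le

/-- **Support S0 of the lane's R96 core (`RotStripBlimPos`): `0 < ⨆_W B^{⊥,→}_{D(H,W)}(x_c)` for every `H ≥ 1`**, i.e. Beaton's
`B_T(x_c) = lim_L B_{T,L}(x_c) > 0`. [cite: Beaton2014RotatedHoneycomb, §3–§4 (B_T(x_c) > 0)] -/
theorem iSup_rotStripBR_pos {H : ℕ} (hH : 1 ≤ H) : 0 < ⨆ Wd : ℕ, rotStripBR H Wd :=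
  (rotStripBR_pos hH).trans_le (le_ciSup (rotStripBR_bddAbove hH) (H + 1))

end Literature.Probability.RandomPlanarGeometry.SAW.HV
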